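import Summits.ValiantsHypothesis.ValiantsHypothesis.Theorems.BarrierLeverChowHitsThinRowPartitionMinorsRDefectOne

/-!
# Route BarrierLever — item `ChowHitsThinRowPartitionMinorsR` (stmt-ValiantsHypothesis-21850, budget
# `h·h`): relabelling lemma for a star of x-dedicated pair rows with ARBITRARY leaf labels

Helper file (`--supports stmt-ValiantsHypothesis-21850`; cell valiant-natproofs, rung V4, 𝒟-side; seat
val-np-p5 gen 28).  Closes NO item; definition-free.  `exists_bigStarRelabel` generalises
`exists_starRelabel` (p697490): the pair row `{a₀, x}` of the star is x-dedicated with an ARBITRARY basis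
label `T x ∋ v₀` (`|T x| ≥ 2`, `T` injective on the leaves), the leaf row `{x}` carrying `T x ∖ {v₀}`,
the centre `{a₀}` carrying `{v₀}`.  Output: a relabelling `U' = U ∘ π` (empty row on `∅`, anchors
placed) with `cost ≤ |Cu| + |B|` or `cost + #SLab ≤ |Cu| + #Sing`, `cost = |Sing.image U' ∪ Cu.image
singleton|`, `SLab` = singleton labels.  Used by `…RBigStar` / `…RNearFullAll`.  Nothing here bears on
items 21882 / 19717, crux 14610, or `VP` versus `VNP`.
-/

set_option linter.dupNamespace false

namespace Summit.ValiantsHypothesis.ValiantsHypothesis.Theorems.BarrierLever.ChowThinHH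

open Finset MvPolynomial

variable {h r : ℕ}

/-- **Big-leaf star relabelling lemma** (see the module docstring). -/
theorem exists_bigStarRelabel (u w : Fin r → Finset (Fin h)) (hu : Function.Injective u)
    (U : Fin r → Finset (Fin h)) (hUinj : Function.Injective U)
    (hUdown : ∀ i (S : Finset (Fin h)), S ⊆ U i → ∃ i', U i' = S)
    (hZ : (Matrix.of fun i j : Fin r => if U i ⊆ w j then (1 : ℂ) else 0).det ≠ 0)
    (a₀ : Fin h) (B : Finset (Fin h)) (haB : a₀ ∉ B)
    (σ : Fin h → Fin r) (hσ : ∀ x ∈ insert a₀ B, u (σ x) = {x})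
    (ρ : Fin h → Fin r) (hρ : ∀ x ∈ B, u (ρ x) = {a₀, x})
    (v₀ : Fin h) (hv₀U : ∃ j, U j = {v₀})
    (T : Fin h → Finset (Fin h)) (hT : ∀ x ∈ B, ∃ j, U j = T x) (hTv : ∀ x ∈ B, v₀ ∈ T x)
    (hT2 : ∀ x ∈ B, 2 ≤ (T x).card) (hTinj : Set.InjOn T B) :
    ∃ U' : Fin r → Finset (Fin h), Function.Injective U' ∧
      (∀ i (S : Finset (Fin h)), S ⊆ U' i → ∃ i', U' i' = S) ∧
      (∀ i, u i = ∅ → U' i = ∅) ∧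
      (Matrix.of fun i j : Fin r => if U' i ⊆ w j then (1 : ℂ) else 0).det ≠ 0 ∧
      U' (σ a₀) = {v₀} ∧ (∀ x ∈ B, U' (σ x) = (T x).erase v₀) ∧ (∀ x ∈ B, U' (ρ x) = T x) ∧
      (((Finset.univ.filter fun i : Fin r => (u i).card = 1).image U' ∪
          (Finset.univ.biUnion w).image fun c : Fin h => ({c} : Finset (Fin h))).card ≤
          (Finset.univ.biUnion w).card + B.card ∨
        ((Finset.univ.filter fun i : Fin r => (u i).card = 1).image U' ∪
          (Finset.univ.biUnion w).image fun c : Fin h => ({c} : Finset (Fin h))).card +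
          (Finset.univ.filter fun j : Fin r => (U j).card = 1).card ≤
          (Finset.univ.biUnion w).card + (Finset.univ.filter fun i : Fin r => (u i).card = 1).card) := by
  classical
  set Sing : Finset (Fin r) := Finset.univ.filter fun i : Fin r => (u i).card = 1 with hSing
  set SLab : Finset (Fin r) := Finset.univ.filter fun j : Fin r => (U j).card = 1 with hSLab
  set Cu : Finset (Fin h) := Finset.univ.biUnion w with hCu
  -- labels: `j₀ ↦ {v₀}`, `labp x ↦ T x`, `lab1 x ↦ T x ∖ {v₀}` (`x ∈ B`), `je ↦ ∅`
  obtain ⟨j₀, hj₀⟩ := hv₀U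
  set labp : Fin h → Fin r := fun x => if hx : x ∈ B then Classical.choose (hT x hx) else j₀
    with hlabp_def
  have hlabp : ∀ x ∈ B, U (labp x) = T x := by
    intro x hx
    simp only [hlabp_def, dif_pos hx]
    exact Classical.choose_spec (hT x hx)
  have hsub1 : ∀ x ∈ B, (T x).erase v₀ ⊆ U (labp x) := fun x hx => by
    rw [hlabp x hx]; exact Finset.erase_subset _ _
  set lab1 : Fin h → Fin r := fun x =>
    if hx : x ∈ B then Classical.choose (hUdown (labp x) ((T x).erase v₀) (hsub1 x hx)) else j₀
    with hlab1_def
  have hlab1 : ∀ x ∈ B, U (lab1 x) = (T x).erase v₀ := by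
    intro x hx
    simp only [hlab1_def, dif_pos hx]
    exact Classical.choose_spec (hUdown (labp x) ((T x).erase v₀) (hsub1 x hx))
  have hlab1a : lab1 a₀ = j₀ := by simp only [hlab1_def, dif_neg haB]
  -- the label set `Λ x` of the anchor singleton row `σ x`
  set Λ : Fin h → Finset (Fin h) := fun x => if x ∈ B then (T x).erase v₀ else {v₀} with hΛ
  have hUlab1 : ∀ x ∈ insert a₀ B, U (lab1 x) = Λ x := by
    intro x hx
    rcases Finset.mem_insert.mp hx with rfl | hx
    · rw [hlab1a, hj₀]; simp only [hΛ, if_neg haB]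
    · rw [hlab1 x hx]; simp only [hΛ, if_pos hx]
  have hTins : ∀ x ∈ B, insert v₀ ((T x).erase v₀) = T x := fun x hx =>
    Finset.insert_erase (hTv x hx)
  have hΛne : ∀ x ∈ insert a₀ B, Λ x ≠ ∅ := by
    intro x hx e
    simp only [hΛ] at e
    split_ifs at e with hxB
    · have h2 := hT2 x hxB
      rw [← hTins x hxB, e] at h2
      simp at h2
    · exact Finset.singleton_ne_empty v₀ e
  have hΛinj : ∀ x ∈ insert a₀ B, ∀ x' ∈ insert a₀ B, Λ x = Λ x' → x = x' := by
    intro x hx x' hx' e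
    simp only [hΛ] at e
    rcases Finset.mem_insert.mp hx with rfl | hxB <;> rcases Finset.mem_insert.mp hx' with rfl | hx'B
    · rfl
    · rw [if_neg haB, if_pos hx'B] at e
      have : v₀ ∈ (T x').erase v₀ := by rw [← e]; exact Finset.mem_singleton_self v₀
      exact absurd this (Finset.notMem_erase v₀ (T x'))
    · rw [if_pos hxB, if_neg haB] at e
      have : v₀ ∈ (T x).erase v₀ := by rw [e]; exact Finset.mem_singleton_self v₀
      exact absurd this (Finset.notMem_erase v₀ (T x))
    · rw [if_pos hxB, if_pos hx'B] at e
      exact hTinj hxB hx'B (by rw [← hTins x hxB, ← hTins x' hx'B, e])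
  have hΛT : ∀ x ∈ insert a₀ B, ∀ x' ∈ B, Λ x ≠ T x' := by
    intro x hx x' hx' e
    simp only [hΛ] at e
    split_ifs at e with hxB
    · have : v₀ ∈ (T x).erase v₀ := by rw [e]; exact hTv x' hx'
      exact absurd this (Finset.notMem_erase v₀ (T x))
    · have h2 := hT2 x' hx'
      rw [← e, Finset.card_singleton] at h2
      exact absurd h2 (by norm_num)
  have hT0 : ∀ x ∈ B, T x ≠ ∅ := fun x hx e => by have h2 := hT2 x hx; rw [e] at h2; simp at h2
  obtain ⟨je, hje⟩ : ∃ j, U j = ∅ := hUdown j₀ ∅ (Finset.empty_subset _)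
  -- a singleton label is a used singleton
  have hlab_used : ∀ i c, U i = {c} → c ∈ Cu := by
    intro i c hic
    by_contra hc
    refine hZ (Matrix.det_eq_zero_of_row_eq_zero i fun j => ?_)
    rw [Matrix.of_apply, if_neg]
    intro hsub
    refine hc (by rw [hCu, Finset.mem_biUnion]; exact ⟨j, Finset.mem_univ _, hsub (by rw [hic]; simp)⟩)
  have hSLabCu : SLab.image U ⊆ Cu.image fun c : Fin h => ({c} : Finset (Fin h)) := by
    intro S hS
    obtain ⟨j, hj, rfl⟩ := Finset.mem_image.mp hS
    obtain ⟨c, hc⟩ := Finset.card_eq_one.mp (Finset.mem_filter.mp hj).2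
    exact Finset.mem_image.mpr ⟨c, hlab_used j c hc, hc.symm⟩
  -- anchors: rows `AnchR = σ(insert a₀ B)`; leaves `B₁` whose label is a singleton label
  set AnchR : Finset (Fin r) := (insert a₀ B).image σ with hAnchR
  set B₁ : Finset (Fin h) := B.filter fun x => lab1 x ∈ SLab with hB₁
  set AnchL₁ : Finset (Fin r) := (insert a₀ B₁).image lab1 with hAnchL₁
  have hB₁sub : B₁ ⊆ B := Finset.filter_subset _ _
  have haB₁ : a₀ ∉ B₁ := fun hx => haB (hB₁sub hx)
  have hσinj : ∀ x ∈ insert a₀ B, ∀ x' ∈ insert a₀ B, σ x = σ x' → x = x' := fun x hx x' hx' e =>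
    Finset.singleton_injective ((hσ x hx).symm.trans ((congrArg u e).trans (hσ x' hx')))
  have hlab1inj : ∀ x ∈ insert a₀ B, ∀ x' ∈ insert a₀ B, lab1 x = lab1 x' → x = x' :=
    fun x hx x' hx' e => hΛinj x hx x' hx' (by rw [← hUlab1 x hx, ← hUlab1 x' hx', e])
  have hxa : ∀ x ∈ B, x ≠ a₀ := fun x hx e => haB (e ▸ hx)
  have hρcard : ∀ x ∈ B, (u (ρ x)).card = 2 := fun x hx => by
    rw [hρ x hx, Finset.card_pair (hxa x hx).symm]
  have hρinj : ∀ x ∈ B, ∀ x' ∈ B, ρ x = ρ x' → x = x' := by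
    intro x hx x' hx' e
    have e2 : ({a₀, x} : Finset (Fin h)) = {a₀, x'} := (hρ x hx).symm.trans ((congrArg u e).trans (hρ x' hx'))
    have hx2 : x ∈ ({a₀, x'} : Finset (Fin h)) := by rw [← e2]; simp
    rcases Finset.mem_insert.mp hx2 with h1 | h1
    · exact absurd h1 (hxa x hx)
    · exact Finset.mem_singleton.mp h1
  have hσρ : ∀ x ∈ insert a₀ B, ∀ x' ∈ B, σ x ≠ ρ x' := by
    intro x hx x' hx' e
    have := congrArg (fun i => (u i).card) e
    simp only [hσ x hx, Finset.card_singleton, hρcard x' hx'] at this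
    exact absurd this (by norm_num)
  have hσcard : ∀ x ∈ insert a₀ B, (u (σ x)).card = 1 := fun x hx => by rw [hσ x hx, Finset.card_singleton]
  have hAnchR_sub : AnchR ⊆ Sing := by
    intro i hi
    obtain ⟨x, hx, rfl⟩ := Finset.mem_image.mp hi
    exact Finset.mem_filter.mpr ⟨Finset.mem_univ _, hσcard x hx⟩
  have hAnchL₁_sub : AnchL₁ ⊆ SLab := by
    intro j hj
    obtain ⟨x, hx, rfl⟩ := Finset.mem_image.mp hj
    rcases Finset.mem_insert.mp hx with rfl | hx
    · rw [hlab1a]; exact Finset.mem_filter.mpr ⟨Finset.mem_univ _, by rw [hj₀, Finset.card_singleton]⟩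
    · exact (Finset.mem_filter.mp hx).2
  have hAnchR_card : AnchR.card = B.card + 1 := by
    rw [hAnchR, Finset.card_image_of_injOn (fun x hx x' hx' e => hσinj x hx x' hx' e),
      Finset.card_insert_of_notMem haB]
  have hAnchL₁_card : AnchL₁.card = B₁.card + 1 := by
    rw [hAnchL₁, Finset.card_image_of_injOn (fun x hx x' hx' e => hlab1inj x
        (Finset.insert_subset_insert _ hB₁sub hx) x' (Finset.insert_subset_insert _ hB₁sub hx') e),
      Finset.card_insert_of_notMem haB₁]
  -- matching of the remaining singleton labels with the remaining singleton rows
  set SLab' : Finset (Fin r) := SLab \ AnchL₁ with hSLab'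
  set Sing' : Finset (Fin r) := Sing \ AnchR with hSing'
  obtain ⟨M, hMsub, hMcard, g, hg⟩ : ∃ M : Finset (Fin r), M ⊆ Sing' ∧
      M.card = min Sing'.card SLab'.card ∧ ∃ g : Fin r → Fin r, Set.InjOn g M ∧ ∀ i ∈ M, g i ∈ SLab' := by
    obtain ⟨M, hMsub, hMcard⟩ := Finset.exists_subset_card_eq
      (show min Sing'.card SLab'.card ≤ Sing'.card from min_le_left _ _)
    have hle : M.card ≤ SLab'.card := by rw [hMcard]; exact min_le_right _ _
    have hc : Fintype.card M ≤ Fintype.card SLab' := by simpa using hle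
    obtain ⟨ι⟩ := Function.Embedding.nonempty_of_card_le hc
    refine ⟨M, hMsub, hMcard, fun i => if hi : i ∈ M then (ι ⟨i, hi⟩ : Fin r) else i, ?_, ?_⟩
    · intro i hi i' hi' e
      simp only [dif_pos (show i ∈ M from hi), dif_pos (show i' ∈ M from hi')] at e
      have := ι.injective (Subtype.ext e)
      exact congrArg Subtype.val this
    · intro i hi
      simp only [dif_pos hi]
      exact (ι ⟨i, hi⟩).2
  have hMfacts : ∀ i ∈ M, (u i).card = 1 ∧ i ∉ AnchR := fun i hi => by
    have hi' := hMsub hi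
    rw [hSing', Finset.mem_sdiff] at hi'
    exact ⟨(Finset.mem_filter.mp hi'.1).2, hi'.2⟩
  have hgfacts : ∀ i ∈ M, (U (g i)).card = 1 ∧ g i ∉ AnchL₁ := fun i hi => by
    have hgi := hg.2 i hi
    rw [hSLab', Finset.mem_sdiff] at hgi
    exact ⟨(Finset.mem_filter.mp hgi.1).2, hgi.2⟩
  have hlab1_ne_g : ∀ x ∈ insert a₀ B, ∀ i ∈ M, lab1 x ≠ g i := by
    intro x hx i hi e
    have hgS : g i ∈ SLab := Finset.mem_filter.mpr ⟨Finset.mem_univ _, (hgfacts i hi).1⟩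
    apply (hgfacts i hi).2
    rw [← e]
    rcases Finset.mem_insert.mp hx with rfl | hxB
    · exact Finset.mem_image_of_mem lab1 (Finset.mem_insert_self _ _)
    · refine Finset.mem_image_of_mem lab1 (Finset.mem_insert_of_mem ?_)
      exact Finset.mem_filter.mpr ⟨hxB, by rw [e]; exact hgS⟩
  -- the row → label assignment on the constrained rows `C`
  set Zr : Finset (Fin r) := Finset.univ.filter fun i : Fin r => u i = ∅ with hZr
  set Xd : Finset (Fin r) := B.image ρ with hXd
  set C : Finset (Fin r) := ((Zr ∪ AnchR) ∪ Xd) ∪ M with hC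
  set f : Fin r → Fin r := fun i =>
    if u i = ∅ then je else
      if h1 : ∃ x, x ∈ insert a₀ B ∧ σ x = i then lab1 (Classical.choose h1) else
        if h2 : ∃ x, x ∈ B ∧ ρ x = i then labp (Classical.choose h2) else g i with hf
  have hfZ : ∀ i, u i = ∅ → f i = je := fun i hi => by simp only [hf, if_pos hi]
  have hfσ : ∀ x ∈ insert a₀ B, f (σ x) = lab1 x := by
    intro x hx
    have hne : u (σ x) ≠ ∅ := by rw [hσ x hx]; exact Finset.singleton_ne_empty x
    have h1 : ∃ x', x' ∈ insert a₀ B ∧ σ x' = σ x := ⟨x, hx, rfl⟩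
    have hspec := Classical.choose_spec h1
    have hx' : Classical.choose h1 = x := hσinj _ hspec.1 _ hx hspec.2
    simp only [hf, if_neg hne, dif_pos h1, hx']
  have hfρ : ∀ x ∈ B, f (ρ x) = labp x := by
    intro x hx
    have hne : u (ρ x) ≠ ∅ := fun e => by
      have := hρcard x hx; rw [e, Finset.card_empty] at this; exact absurd this (by norm_num)
    have h1 : ¬ ∃ x', x' ∈ insert a₀ B ∧ σ x' = ρ x := fun ⟨x', hx', e⟩ => hσρ x' hx' x hx e
    have h2 : ∃ x', x' ∈ B ∧ ρ x' = ρ x := ⟨x, hx, rfl⟩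
    have hspec := Classical.choose_spec h2
    have hx' : Classical.choose h2 = x := hρinj _ hspec.1 _ hx hspec.2
    simp only [hf, if_neg hne, dif_neg h1, dif_pos h2, hx']
  have hfM : ∀ i ∈ M, f i = g i := by
    intro i hi
    have hne : u i ≠ ∅ := fun e => by
      have := (hMfacts i hi).1; rw [e, Finset.card_empty] at this; exact absurd this (by norm_num)
    have h1 : ¬ ∃ x', x' ∈ insert a₀ B ∧ σ x' = i := fun ⟨x', hx', e⟩ =>
      (hMfacts i hi).2 (Finset.mem_image.mpr ⟨x', hx', e⟩)
    have h2 : ¬ ∃ x', x' ∈ B ∧ ρ x' = i := fun ⟨x', hx', e⟩ => by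
      have := (hMfacts i hi).1; rw [← e, hρcard x' hx'] at this; exact absurd this (by norm_num)
    simp only [hf, if_neg hne, dif_neg h1, dif_neg h2]
  -- the label SETS on `C` and injectivity
  have hUfσ : ∀ x ∈ insert a₀ B, U (f (σ x)) = Λ x := fun x hx => by rw [hfσ x hx, hUlab1 x hx]
  have hUfρ : ∀ x ∈ B, U (f (ρ x)) = T x := fun x hx => by rw [hfρ x hx, hlabp x hx]
  have hinj : Set.InjOn f C := by
    intro i hi i' hi' e
    have eU : U (f i) = U (f i') := by rw [e]
    simp only [hC, Finset.coe_union, Set.mem_union, Finset.mem_coe, hZr, Finset.mem_filter,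
      Finset.mem_univ, true_and] at hi hi'
    rcases hi with ((hi | hi) | hi) | hi <;> rcases hi' with ((hi' | hi') | hi') | hi'
    · exact hu (hi.trans hi'.symm)
    · obtain ⟨x', hx', rfl⟩ := Finset.mem_image.mp hi'
      rw [hfZ i hi, hje, hUfσ x' hx'] at eU
      exact absurd eU.symm (hΛne x' hx')
    · obtain ⟨x', hx', rfl⟩ := Finset.mem_image.mp hi'
      rw [hfZ i hi, hje, hUfρ x' hx'] at eU
      exact absurd eU.symm (hT0 x' hx')
    · rw [hfZ i hi, hje, hfM i' hi'] at eU
      exact absurd (congrArg Finset.card eU) (by rw [(hgfacts i' hi').1, Finset.card_empty]; norm_num)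
    · obtain ⟨x, hx, rfl⟩ := Finset.mem_image.mp hi
      rw [hfZ i' hi', hje, hUfσ x hx] at eU
      exact absurd eU (hΛne x hx)
    · obtain ⟨x, hx, rfl⟩ := Finset.mem_image.mp hi
      obtain ⟨x', hx', rfl⟩ := Finset.mem_image.mp hi'
      rw [hUfσ x hx, hUfσ x' hx'] at eU
      rw [hΛinj x hx x' hx' eU]
    · obtain ⟨x, hx, rfl⟩ := Finset.mem_image.mp hi
      obtain ⟨x', hx', rfl⟩ := Finset.mem_image.mp hi'
      rw [hUfσ x hx, hUfρ x' hx'] at eU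
      exact absurd eU (hΛT x hx x' hx')
    · obtain ⟨x, hx, rfl⟩ := Finset.mem_image.mp hi
      rw [hfσ x hx, hfM i' hi'] at e
      exact absurd e (hlab1_ne_g x hx i' hi')
    · obtain ⟨x, hx, rfl⟩ := Finset.mem_image.mp hi
      rw [hfZ i' hi', hje, hUfρ x hx] at eU
      exact absurd eU (hT0 x hx)
    · obtain ⟨x, hx, rfl⟩ := Finset.mem_image.mp hi
      obtain ⟨x', hx', rfl⟩ := Finset.mem_image.mp hi'
      rw [hUfρ x hx, hUfσ x' hx'] at eU
      exact absurd eU.symm (hΛT x' hx' x hx)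
    · obtain ⟨x, hx, rfl⟩ := Finset.mem_image.mp hi
      obtain ⟨x', hx', rfl⟩ := Finset.mem_image.mp hi'
      rw [hUfρ x hx, hUfρ x' hx'] at eU
      rw [hTinj hx hx' eU]
    · obtain ⟨x, hx, rfl⟩ := Finset.mem_image.mp hi
      rw [hUfρ x hx, hfM i' hi'] at eU
      have h2 := hT2 x hx
      rw [eU, (hgfacts i' hi').1] at h2
      exact absurd h2 (by norm_num)
    · rw [hfM i hi, hfZ i' hi', hje] at eU
      exact absurd (congrArg Finset.card eU) (by rw [(hgfacts i hi).1, Finset.card_empty]; norm_num)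
    · obtain ⟨x', hx', rfl⟩ := Finset.mem_image.mp hi'
      rw [hfM i hi, hfσ x' hx'] at e
      exact absurd e.symm (hlab1_ne_g x' hx' i hi)
    · obtain ⟨x', hx', rfl⟩ := Finset.mem_image.mp hi'
      rw [hfM i hi, hUfρ x' hx'] at eU
      have h2 := hT2 x' hx'
      rw [← eU, (hgfacts i hi).1] at h2
      exact absurd h2 (by norm_num)
    · rw [hfM i hi, hfM i' hi'] at e
      exact hg.1 hi hi' e
  obtain ⟨ge, hge⟩ := Finset.exists_equiv_extend_of_card_eq (t := (Finset.univ : Finset (Fin r)))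
    (by simp) (s := C) (f := f) (Finset.subset_univ _) hinj
  set π : Fin r ≃ Fin r := ge.trans (Equiv.subtypeUnivEquiv Finset.mem_univ) with hπ
  have hπC : ∀ i ∈ C, π i = f i := fun i hi => by rw [← hge i hi]; rfl
  have hZC : ∀ i, u i = ∅ → i ∈ C := fun i hi =>
    Finset.mem_union_left _ (Finset.mem_union_left _ (Finset.mem_union_left _
      (Finset.mem_filter.mpr ⟨Finset.mem_univ _, hi⟩)))
  have hσC : ∀ x ∈ insert a₀ B, σ x ∈ C := fun x hx =>
    Finset.mem_union_left _ (Finset.mem_union_left _ (Finset.mem_union_right _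
      (Finset.mem_image_of_mem σ hx)))
  have hρC : ∀ x ∈ B, ρ x ∈ C := fun x hx =>
    Finset.mem_union_left _ (Finset.mem_union_right _ (Finset.mem_image_of_mem ρ hx))
  have hMC : ∀ i ∈ M, i ∈ C := fun i hi => Finset.mem_union_right _ hi
  -- the relabelling
  set U' : Fin r → Finset (Fin h) := fun i => U (π i) with hU'
  have hU'inj : Function.Injective U' := hUinj.comp π.injective
  have hU'down : ∀ i (S : Finset (Fin h)), S ⊆ U' i → ∃ i', U' i' = S := fun i S hS => by
    obtain ⟨j', hj'⟩ := hUdown (π i) S hS; exact ⟨π.symm j', by simp only [hU', Equiv.apply_symm_apply, hj']⟩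
  have hU'empty : ∀ i, u i = ∅ → U' i = ∅ := fun i hi => by
    show U (π i) = ∅; rw [hπC i (hZC i hi), hfZ i hi, hje]
  have hU'σ : ∀ x ∈ insert a₀ B, U' (σ x) = Λ x := fun x hx => by
    show U (π (σ x)) = Λ x
    rw [hπC _ (hσC x hx), hUfσ x hx]
  have hU'ρ : ∀ x ∈ B, U' (ρ x) = T x := fun x hx => by
    show U (π (ρ x)) = T x
    rw [hπC _ (hρC x hx), hUfρ x hx]
  have hU'M : ∀ i ∈ M, U' i ∈ Cu.image fun c : Fin h => ({c} : Finset (Fin h)) := by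
    intro i hi
    apply hSLabCu
    refine Finset.mem_image.mpr ⟨π i, ?_, rfl⟩
    rw [hπC i (hMC i hi), hfM i hi]
    exact Finset.mem_filter.mpr ⟨Finset.mem_univ _, (hgfacts i hi).1⟩
  have hU'A : ∀ x ∈ insert a₀ B₁, U' (σ x) ∈ Cu.image fun c : Fin h => ({c} : Finset (Fin h)) := by
    intro x hx
    have hx' : x ∈ insert a₀ B := Finset.insert_subset_insert _ hB₁sub hx
    apply hSLabCu
    refine Finset.mem_image.mpr ⟨π (σ x), ?_, rfl⟩
    rw [hπC _ (hσC x hx'), hfσ x hx']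
    exact hAnchL₁_sub (Finset.mem_image_of_mem lab1 hx)
  have hZ' : (Matrix.of fun i j : Fin r => if U' i ⊆ w j then (1 : ℂ) else 0).det ≠ 0 := by
    have e : (Matrix.of fun i j : Fin r => if U' i ⊆ w j then (1 : ℂ) else 0) =
        (Matrix.of fun i j : Fin r => if U i ⊆ w j then (1 : ℂ) else 0).submatrix π id := by
      ext i j; rfl
    rw [e, Matrix.det_permute]
    refine mul_ne_zero ?_ hZ
    rcases Int.units_eq_one_or (Equiv.Perm.sign π) with h1 | h1 <;> simp [h1]
  refine ⟨U', hU'inj, hU'down, hU'empty, hZ', ?_, fun x hx => ?_, hU'ρ, ?_⟩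
  · rw [hU'σ a₀ (Finset.mem_insert_self _ _)]; simp only [hΛ, if_neg haB]
  · rw [hU'σ x (Finset.mem_insert_of_mem hx)]; simp only [hΛ, if_pos hx]
  -- the cost bound
  have hsub : Sing.image U' ∪ Cu.image (fun c : Fin h => ({c} : Finset (Fin h))) ⊆
      ((Sing \ (AnchR ∪ M)).image U' ∪ (B \ B₁).image (fun x => U' (σ x))) ∪
        Cu.image (fun c : Fin h => ({c} : Finset (Fin h))) := by
    intro S hS
    rcases Finset.mem_union.mp hS with h1 | h2
    · obtain ⟨i, hi, rfl⟩ := Finset.mem_image.mp h1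
      by_cases hiA : i ∈ AnchR
      · obtain ⟨x, hx, rfl⟩ := Finset.mem_image.mp hiA
        by_cases hx1 : x ∈ insert a₀ B₁
        · exact Finset.mem_union_right _ (hU'A x hx1)
        · have hxB : x ∈ B \ B₁ := by
            rcases Finset.mem_insert.mp hx with rfl | hxB
            · exact absurd (Finset.mem_insert_self _ _) hx1
            · exact Finset.mem_sdiff.mpr ⟨hxB, fun h1 => hx1 (Finset.mem_insert_of_mem h1)⟩
          exact Finset.mem_union_left _ (Finset.mem_union_right _
            (Finset.mem_image.mpr ⟨x, hxB, rfl⟩))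
      by_cases hiM : i ∈ M
      · exact Finset.mem_union_right _ (hU'M i hiM)
      · exact Finset.mem_union_left _ (Finset.mem_union_left _ (Finset.mem_image.mpr
          ⟨i, Finset.mem_sdiff.mpr ⟨hi, by rw [Finset.mem_union, not_or]; exact ⟨hiA, hiM⟩⟩, rfl⟩))
    · exact Finset.mem_union_right _ h2
  have hAMsub : AnchR ∪ M ⊆ Sing := Finset.union_subset hAnchR_sub
    (fun i hi => (Finset.mem_sdiff.mp (hMsub hi)).1)
  have hAMdisj : Disjoint AnchR M := Finset.disjoint_right.mpr fun i hi => (hMfacts i hi).2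
  have hAMcard : (AnchR ∪ M).card = B.card + 1 + M.card := by
    rw [Finset.card_union_of_disjoint hAMdisj, hAnchR_card]
  have hSing'card : Sing'.card = Sing.card - (B.card + 1) := by
    rw [hSing', Finset.card_sdiff_of_subset hAnchR_sub, hAnchR_card]
  have hSLab'card : SLab'.card = SLab.card - (B₁.card + 1) := by
    rw [hSLab', Finset.card_sdiff_of_subset hAnchL₁_sub, hAnchL₁_card]
  have hAle : B.card + 1 ≤ Sing.card := by
    rw [← hAnchR_card]; exact Finset.card_le_card hAnchR_sub
  have hLle : B₁.card + 1 ≤ SLab.card := by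
    rw [← hAnchL₁_card]; exact Finset.card_le_card hAnchL₁_sub
  have hB₁card : (B \ B₁).card = B.card - B₁.card := Finset.card_sdiff_of_subset hB₁sub
  have hB₁le : B₁.card ≤ B.card := Finset.card_le_card hB₁sub
  have hbound : (Sing.image U' ∪ Cu.image (fun c : Fin h => ({c} : Finset (Fin h)))).card ≤
      ((Sing.card - (B.card + 1 + M.card)) + (B.card - B₁.card)) + Cu.card := by
    refine (Finset.card_le_card hsub).trans ((Finset.card_union_le _ _).trans ?_)
    refine Nat.add_le_add ((Finset.card_union_le _ _).trans (Nat.add_le_add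
      (Finset.card_image_le.trans ?_) (Finset.card_image_le.trans (le_of_eq hB₁card))))
      Finset.card_image_le
    rw [Finset.card_sdiff_of_subset hAMsub, hAMcard]
  rw [hSing'card, hSLab'card] at hMcard
  rcases le_total (Sing.card - (B.card + 1)) (SLab.card - (B₁.card + 1)) with hle | hle
  · rw [min_eq_left hle] at hMcard
    left
    omega
  · rw [min_eq_right hle] at hMcard
    right
    omega

end Summit.ValiantsHypothesis.ValiantsHypothesis.Theorems.BarrierLever.ChowThinHH
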